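import Mathlib
import HarnessLib

/-!
# Rung S-2 `PersistenceSurface` (stmt-ResolutionOfSingularities-19970) — POINTED CYCLES II: the negative-definiteness
# bricks of the pointed-cycle ceiling `tr(M_{−δ_t}) ⊆ I(Z⁽ᵗ⁾ − A⁽ᵗ⁾)` (memo K-PCC §2, res-L1-w44b-lead-1 g4)

Route `ResolutionOfSingularities/HomologicalConductor`, chain W4.4b (cell `res-hironaka`), rung S-2
`PersistenceSurface` (stmt-ResolutionOfSingularities-19970), registered stub
`stub_levelFourPersistenceNonnormalOrNonrational'` (C3′) and the local core.  `[OURS · L1 w44b]`; replaces the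
role of no printed item; NOT a statement of the manuscript under review (Hironaka 2017), nothing of it is used;
AI-written elementary linear algebra over `ℤ`, weaker than expert review.  Def-free; companion of
`…PersistencePointedCycles` (p564614: Artin closure, least/greatest pointed cycles, restriction and pyramid lemmas),
independent of it.

## Setting and content

`M : ι → ι → ℤ` is an abstract «intersection matrix» of the exceptional curves `C_i` of a resolution of a normal
surface germ: non-negative OFF the diagonal (`hoff`) and NEGATIVE DEFINITE, which we phrase through the pairing
`N·C_i = Σ_j N_j M j i` as **`hneg : ∀ N, 0 ≤ Σ_i N_i (N·C_i) → N = 0`** (`N·N < 0` for `N ≠ 0`; no symmetry of `M`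
is needed in this form).  Cycles with signs are `ι → ℤ`, effective ones `ι → ℕ`; the weight `δ_it` is
`if i = t then 1 else 0`.  In the geometry (memo K-PCC §1–2), for a line bundle `ℒ` of multidegree `d` and a section
`s ∈ H⁰(X∖E, ℒ)` with exceptional part `P_s`, one has (★) `P_s·C_i ≤ d_i`; the lattice statements below turn (★)
into the ceiling:

* `nonpos_of_nef` — **(N1) nef ⇒ non-positive**: `N·C_i ≥ 0 ∀ i ⇒ N ≤ 0` (positive part `N⁺` has
  `N⁺·C_i ≥ N·C_i ≥ 0` on its support, so `N⁺·N⁺ ≥ 0`, so `N⁺ = 0`); hence `nonneg_of_isPointedAntinef`: a cycle with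
  `P·C_i ≤ −δ_it` (sections of `ℒ_{−δ_t}`) is EFFECTIVE — «no poles»;
* `one_le_apply_of_isPointedAlmostNef` — **corner of an almost-nef cycle**: `A ≥ 0`, `A ≠ 0`, `A·C_i ≥ −δ_it ∀ i`
  forces `A_t ≥ 1` (otherwise `A·A ≥ 0`); with the box bound `(D_t)_t < 1` this is the NP(t) criterion of memo §3(a);
* `negPart_isPointedAlmostNef` — for a cycle `Q` with `Q·C_i ≤ δ_it` (sections of `ℒ_{+δ_t}`), the negative part
  `Q⁻` is almost nef at `t`, so `Q ≥ −A⁽ᵗ⁾`;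
* `least_sub_greatest_le_add` — **the ceiling, lattice form** (memo Thm 2.3): if `Z₀` is below every effective cycle
  pointed anti-nef at `t` and `A₀` above every effective cycle almost nef at `t`, then for every `P` with
  `P·C_i ≤ −δ_it` and `Q` with `Q·C_i ≤ δ_it`: **`Z₀ − A₀ ≤ P + Q`** — the exceptional order of a product `s·s'`
  (`s` a section of `ℒ_{−δ_t}`, `s'` of `ℒ_{+δ_t}`, `Z_{ss'} = P_s + P_{s'}`) is at least `Z⁽ᵗ⁾ − A⁽ᵗ⁾`, i.e.
  `tr(M_{−δ_t}) ⊆ I(Z⁽ᵗ⁾ − A⁽ᵗ⁾)` once (★), `ca³ ⊆ tr` (tree `TraceIdealBound`) and the order map are supplied by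
  the sheaf half (W4.4's `NoZeno` resolution vocabulary).
* `two_mul_le_add_of_numericallyTrivial` — the `Pic⁰` ceiling, lattice form (memo Thm 2.4): multidegree `0`,
  `P_s, P_{s'} ≠ 0` ⇒ `P_s + P_{s'} ≥ 2·Z_f` given the fundamental cycle `Z_f` below every non-zero anti-nef cycle.

References (mechanism only): M. Artin, Amer. J. Math. 88 (1966); J. Lipman, Publ. IHÉS 36 (1969) §12, §18
[`Lipman1969`]; this work (memo K-PCC, evidence #45 on stmt-19970).
-/

-- single-problem summit: the doubled namespace component `ResolutionOfSingularities` is forced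
set_option linter.dupNamespace false

namespace Summit.ResolutionOfSingularities.ResolutionOfSingularities.Theorems.HomologicalConductor.PersistencePointedCyclesDefinite

open Finset

variable {ι : Type*} [Fintype ι] [DecidableEq ι]

/-! ## (N1) nef ⇒ non-positive -/

omit [DecidableEq ι] in
/-- The positive part only raises the pairing on its support: if `N i > 0` then `N⁺·C_i ≥ N·C_i`
(`N⁺ = max(N, 0)`; the dropped negative coefficients met `C_i` non-negatively). [this work] -/
theorem sum_mul_le_sum_posPart_mul (M : ι → ι → ℤ) (hoff : ∀ i j, i ≠ j → 0 ≤ M i j) (N : ι → ℤ) (i : ι)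
    (hi : 0 < N i) : ∑ j, N j * M j i ≤ ∑ j, max (N j) 0 * M j i := by
  refine sum_le_sum fun j _ => ?_
  by_cases hji : j = i
  · subst hji; rw [max_eq_left hi.le]
  · exact mul_le_mul_of_nonneg_right (le_max_left _ _) (hoff j i hji)

omit [DecidableEq ι] in
/-- **(N1) A nef cycle is non-positive** (negative definiteness): if `N·C_i ≥ 0` for every `i` then `N ≤ 0`.
Proof: `N⁺·N⁺ = Σ_i N⁺_i (N⁺·C_i) ≥ Σ_{N_i>0} N_i (N·C_i) ≥ 0`, so `N⁺ = 0`.  In the geometry: a rational section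
of a line bundle of non-positive multidegree over the punctured germ has no poles along `E`. [cite: Lipman1969, §12]
-/
theorem nonpos_of_nef (M : ι → ι → ℤ) (hoff : ∀ i j, i ≠ j → 0 ≤ M i j)
    (hneg : ∀ N : ι → ℤ, 0 ≤ ∑ i, N i * ∑ j, N j * M j i → N = 0)
    (N : ι → ℤ) (hnef : ∀ i, 0 ≤ ∑ j, N j * M j i) : N ≤ 0 := by
  set P : ι → ℤ := fun i => max (N i) 0 with hP
  have hP0 : P = 0 := by
    refine hneg P (sum_nonneg fun i _ => ?_)
    by_cases hi : 0 < N i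
    · have h1 : P i = N i := by simp [hP, hi.le]
      rw [h1]
      exact mul_nonneg hi.le ((hnef i).trans (sum_mul_le_sum_posPart_mul M hoff N i hi))
    · have h1 : P i = 0 := by simp [hP, not_lt.mp hi]
      rw [h1, zero_mul]
  intro i
  have h := congr_fun hP0 i
  simp only [hP, Pi.zero_apply] at h
  have := le_max_left (N i) 0
  rw [h] at this
  exact this

omit [DecidableEq ι] in
/-- Dually, an **anti-nef cycle is non-negative**: `Z·C_i ≤ 0 ∀ i ⇒ 0 ≤ Z`. [cite: Lipman1969, §12] -/
theorem nonneg_of_antinef (M : ι → ι → ℤ) (hoff : ∀ i j, i ≠ j → 0 ≤ M i j)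
    (hneg : ∀ N : ι → ℤ, 0 ≤ ∑ i, N i * ∑ j, N j * M j i → N = 0)
    (Z : ι → ℤ) (hZ : ∀ i, ∑ j, Z j * M j i ≤ 0) : 0 ≤ Z := by
  have h := nonpos_of_nef M hoff hneg (-Z) fun i => by
    have : ∑ j, (-Z) j * M j i = -∑ j, Z j * M j i := by
      rw [← sum_neg_distrib]; exact sum_congr rfl fun j _ => by simp [neg_mul]
    rw [this]; linarith [hZ i]
  intro i
  have := h i
  simp only [Pi.neg_apply, Pi.zero_apply, Left.neg_nonpos_iff] at this
  exact this

/-- **Sections of `ℒ_{−δ_t}` have no poles**: a cycle with `P·C_i ≤ −δ_it` is effective (and is then a member of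
`𝒫_t`). [this work] -/
theorem nonneg_of_isPointedAntinef (M : ι → ι → ℤ) (hoff : ∀ i j, i ≠ j → 0 ≤ M i j)
    (hneg : ∀ N : ι → ℤ, 0 ≤ ∑ i, N i * ∑ j, N j * M j i → N = 0) (t : ι)
    (P : ι → ℤ) (hP : ∀ i, ∑ j, P j * M j i ≤ -(if i = t then 1 else 0)) : 0 ≤ P :=
  nonneg_of_antinef M hoff hneg P fun i => (hP i).trans (by split_ifs <;> norm_num)

/-! ## The corner of an almost-nef cycle (NP criterion) -/

/-- **An almost-nef effective cycle is supported at its corner**: if `A ≥ 0`, `A·C_i ≥ −δ_it` for all `i` and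
`A ≠ 0`, then `A_t ≥ 1`.  (Otherwise every term `A_i (A·C_i)` is `≥ 0` — at `t` because `A_t = 0`, elsewhere
because `A·C_i ≥ 0` — so `A·A ≥ 0` and `A = 0`.)  With a box bound `A ≤ D_t`, `(D_t)_t < 1` this is NP(t):
`𝒜_t = {0}` (memo K-PCC §3(a)). [this work] -/
theorem one_le_apply_of_isPointedAlmostNef (M : ι → ι → ℤ)
    (hneg : ∀ N : ι → ℤ, 0 ≤ ∑ i, N i * ∑ j, N j * M j i → N = 0) (t : ι)
    (A : ι → ℕ) (hA : ∀ i, -(if i = t then (1 : ℤ) else 0) ≤ ∑ j, (A j : ℤ) * M j i) (hne : A ≠ 0) :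
    1 ≤ A t := by
  by_contra ht
  push Not at ht
  have ht0 : A t = 0 := by omega
  apply hne
  have h := hneg (fun i => (A i : ℤ)) (sum_nonneg fun i _ => ?_)
  · funext i
    have := congr_fun h i
    simp only [Pi.zero_apply, Nat.cast_eq_zero] at this
    simpa using this
  · by_cases hit : i = t
    · subst hit; simp [ht0]
    · have h1 : (0 : ℤ) ≤ ∑ j, (A j : ℤ) * M j i := by
        have := hA i; simp only [hit, if_false, neg_zero] at this; exact this
      exact mul_nonneg (Nat.cast_nonneg _) h1

/-! ## Sections of `ℒ_{+δ_t}`: poles are bounded by the almost-nef excess -/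

/-- **The negative part of a cycle with `Q·C_i ≤ δ_it` is almost nef at `t`**: `Q⁻ := max(−Q, 0)` satisfies
`Q⁻·C_i ≥ −δ_it` (on `Supp Q⁻`: `Q⁻·C_i ≥ −Q·C_i ≥ −δ_it`, the dropped part `Q⁺` meeting `C_i` non-negatively; off
the support: `Q⁻·C_i ≥ 0`).  Hence `Q⁻ ≤ A⁽ᵗ⁾` and `Q ≥ −A⁽ᵗ⁾` — the poles of a section of `ℒ_{+δ_t}` over the
punctured germ are bounded by the almost-nef excess (memo K-PCC Thm 2.3, second half). [this work] -/
theorem negPart_isPointedAlmostNef (M : ι → ι → ℤ) (hoff : ∀ i j, i ≠ j → 0 ≤ M i j) (t : ι)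
    (Q : ι → ℤ) (hQ : ∀ i, ∑ j, Q j * M j i ≤ (if i = t then 1 else 0)) :
    ∀ i, -(if i = t then (1 : ℤ) else 0) ≤ ∑ j, ((fun j => (max (-Q j) 0).toNat) j : ℤ) * M j i := by
  intro i
  have hcast : ∀ j, (((max (-Q j) 0).toNat : ℕ) : ℤ) = max (-Q j) 0 := fun j =>
    Int.toNat_of_nonneg (le_max_right _ _)
  simp only [hcast]
  by_cases hi : Q i < 0
  · -- on the support: compare termwise with `-Q`
    have h1 : -∑ j, Q j * M j i ≤ ∑ j, max (-Q j) 0 * M j i := by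
      rw [← sum_neg_distrib]
      refine sum_le_sum fun j _ => ?_
      by_cases hji : j = i
      · subst hji; rw [max_eq_left (by linarith), neg_mul]
      · rw [← neg_mul]; exact mul_le_mul_of_nonneg_right (le_max_left _ _) (hoff j i hji)
    linarith [hQ i]
  · -- off the support: every term is non-negative
    have h1 : (0 : ℤ) ≤ ∑ j, max (-Q j) 0 * M j i := by
      refine sum_nonneg fun j _ => ?_
      by_cases hji : j = i
      · subst hji; rw [max_eq_right (by linarith), zero_mul]
      · exact mul_nonneg (le_max_right _ _) (hoff j i hji)
    refine le_trans ?_ h1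
    split_ifs <;> norm_num

omit [Fintype ι] [DecidableEq ι] in
/-- The negative part dominates from below: `−Q⁻ ≤ Q`. [folklore] -/
theorem neg_negPart_le (Q : ι → ℤ) : ∀ j, -(((max (-Q j) 0).toNat : ℕ) : ℤ) ≤ Q j := by
  intro j
  rw [Int.toNat_of_nonneg (le_max_right _ _)]
  rcases le_total 0 (Q j) with h | h
  · rw [max_eq_right (by linarith)]; linarith
  · rw [max_eq_left (by linarith)]; linarith

/-! ## The ceiling in lattice form (memo K-PCC Thm 2.3 / Thm 2.4) -/

/-- **POINTED CEILING, lattice form.** Let `Z₀` lie below every effective cycle pointed anti-nef at `t` (e.g. the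
least such, `Z⁽ᵗ⁾`) and `A₀` above every effective cycle almost nef at `t` (the greatest such, `A⁽ᵗ⁾`).  Then for all
cycles `P`, `Q : ι → ℤ` with `P·C_i ≤ −δ_it` and `Q·C_i ≤ δ_it` (the exceptional parts of sections of `ℒ_{−δ_t}` and
of `ℒ_{+δ_t}` over the punctured germ, by (★)): **`Z₀ − A₀ ≤ P + Q`** — the exceptional order of every product
`s·s' ∈ tr(M_{−δ_t})` is at least `Z⁽ᵗ⁾ − A⁽ᵗ⁾`. [this work] -/
theorem least_sub_greatest_le_add (M : ι → ι → ℤ) (hoff : ∀ i j, i ≠ j → 0 ≤ M i j)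
    (hneg : ∀ N : ι → ℤ, 0 ≤ ∑ i, N i * ∑ j, N j * M j i → N = 0) (t : ι) (Z₀ A₀ : ι → ℕ)
    (hZ₀ : ∀ Z : ι → ℕ, (∀ i, ∑ j, (Z j : ℤ) * M j i ≤ -(if i = t then 1 else 0)) → Z₀ ≤ Z)
    (hA₀ : ∀ A : ι → ℕ, (∀ i, -(if i = t then (1 : ℤ) else 0) ≤ ∑ j, (A j : ℤ) * M j i) → A ≤ A₀)
    (P Q : ι → ℤ) (hP : ∀ i, ∑ j, P j * M j i ≤ -(if i = t then 1 else 0))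
    (hQ : ∀ i, ∑ j, Q j * M j i ≤ (if i = t then 1 else 0)) :
    ∀ i, (Z₀ i : ℤ) - A₀ i ≤ P i + Q i := by
  -- `P` is effective, hence a member of `𝒫_t`, hence `≥ Z₀`
  have hPnn : 0 ≤ P := nonneg_of_isPointedAntinef M hoff hneg t P hP
  set P' : ι → ℕ := fun i => (P i).toNat with hP'
  have hPP' : ∀ i, ((P' i : ℕ) : ℤ) = P i := fun i => Int.toNat_of_nonneg (hPnn i)
  have hP'mem : ∀ i, ∑ j, (P' j : ℤ) * M j i ≤ -(if i = t then 1 else 0) := fun i => by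
    simp only [hPP']; exact hP i
  have hZP : Z₀ ≤ P' := hZ₀ P' hP'mem
  -- `Q⁻` is almost nef at `t`, hence `≤ A₀`
  set Qm : ι → ℕ := fun j => (max (-Q j) 0).toNat with hQm
  have hQA : Qm ≤ A₀ := hA₀ Qm (negPart_isPointedAlmostNef M hoff t Q hQ)
  intro i
  have h1 : (Z₀ i : ℤ) ≤ P i := by rw [← hPP' i]; exact_mod_cast hZP i
  have h2 : -(A₀ i : ℤ) ≤ Q i := by
    have h3 : (Qm i : ℤ) ≤ A₀ i := by exact_mod_cast hQA i
    exact le_trans (by linarith) (neg_negPart_le Q i)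
  linarith

omit [DecidableEq ι] in
/-- **`Pic⁰` CEILING, lattice form** (memo K-PCC Thm 2.4).  If `Z_f` lies below every non-zero effective anti-nef
cycle (the fundamental cycle), then for all NON-ZERO cycles `P`, `Q : ι → ℤ` with `P·C_i ≤ 0`, `Q·C_i ≤ 0` (the
exceptional parts of sections of a numerically trivial but non-trivial `ℒ` and of `ℒ⁻¹`; non-zero because `ℒ` is not
trivial near `E`): `2·Z_f ≤ P + Q`.  With `ca³ ⊆ tr` this is `ca³(T) ⊆ I(2Z_f)` for `p_g(T) > 0`. [this work] -/
theorem two_mul_le_add_of_numericallyTrivial (M : ι → ι → ℤ) (hoff : ∀ i j, i ≠ j → 0 ≤ M i j)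
    (hneg : ∀ N : ι → ℤ, 0 ≤ ∑ i, N i * ∑ j, N j * M j i → N = 0) (Zf : ι → ℕ)
    (hZf : ∀ Z : ι → ℕ, Z ≠ 0 → (∀ i, ∑ j, (Z j : ℤ) * M j i ≤ 0) → Zf ≤ Z)
    (P Q : ι → ℤ) (hP0 : P ≠ 0) (hQ0 : Q ≠ 0)
    (hP : ∀ i, ∑ j, P j * M j i ≤ 0) (hQ : ∀ i, ∑ j, Q j * M j i ≤ 0) :
    ∀ i, 2 * (Zf i : ℤ) ≤ P i + Q i := by
  have key : ∀ R : ι → ℤ, R ≠ 0 → (∀ i, ∑ j, R j * M j i ≤ 0) → ∀ i, (Zf i : ℤ) ≤ R i := by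
    intro R hR0 hR
    have hRnn : 0 ≤ R := nonneg_of_antinef M hoff hneg R hR
    set R' : ι → ℕ := fun i => (R i).toNat with hR'
    have hRR' : ∀ i, ((R' i : ℕ) : ℤ) = R i := fun i => Int.toNat_of_nonneg (hRnn i)
    have hR'0 : R' ≠ 0 := by
      intro h
      apply hR0
      funext i
      have := congr_fun h i
      simp only [Pi.zero_apply] at this
      rw [Pi.zero_apply, ← hRR' i, this, Nat.cast_zero]
    have hle : Zf ≤ R' := hZf R' hR'0 fun i => by simp only [hRR']; exact hR i
    intro i
    rw [← hRR' i]; exact_mod_cast hle i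
  intro i
  have h1 := key P hP0 hP i
  have h2 := key Q hQ0 hQ i
  linarith

end Summit.ResolutionOfSingularities.ResolutionOfSingularities.Theorems.HomologicalConductor.PersistencePointedCyclesDefinite
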